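import Mathlib
import Literature.MathematicalPhysics.QuantumFieldTheory.Balaban1983to89.B10Eq39CollarVolume
import Literature.MathematicalPhysics.QuantumFieldTheory.Balaban1983to89.TorusGeometry

/-!
# `Balaban1983to89.B10Eq41TorusHistories` — [Balaban1985UV3] (41) p. 266 «Σ_{{Ω_j}} …» and pp. 273–274: THE DISCRETE
# LARGE-FIELD HISTORIES ON PRINT'S TORUS — the cell's history carrier `B10LargeFieldSum.HistModel` CONSTRUCTED over the fine torus
# `Site P 0` with the candidate (scale, plaquette) pairs, `card_E` («|T₁^{(k)}| = (Lᵏε)^{−3}|T_ε|», three plaquettes per site)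
# PROVED, `zvol` := the collar count of `…B10Eq39CollarVolume`, and the leaf `ZvolCover` of the Sect. D kernel closure as a
# THEOREM; only the three fields that refer to the history functional `LF` of (41) (no body in the tree) remain inputs

T. Bałaban, *Ultraviolet stability of three-dimensional lattice pure gauge field theories*, Commun. Math. Phys. **102**,
255–275 (1985) [Balaban1985UV3] (cell paper B10; held `paper:balaban1985-cmp102-uv-stability-3d`, journal page = PDF page
+ 254; pp. 256, 266, 267, 273 = [PDF 2, 12, 13, 19] re-read 2026-08-25 on the text layers).  «…» = verbatim.

HONEST FRAMING.  Kernel bookkeeping (YM-PLAN Track A, DAG node N08 = [B10], seat `pub-ymgap-dag-n08-b`, third file; written at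
the -a seat's request [N08-A-G0-REPLY-B] (2)): the COMBINATORIAL half of the large-field history carrier on print's torus.  The
history functional `LF` of (41), its domination by the sum over discrete histories, the small factors (67)–(71) as a bound on the
main action and the rate of the Z-terms stay HYPOTHESES (`Inputs`, `SmallFactorsAll`, `ZtermRate`); nothing of (41), (5),
Theorem 1/2 is asserted; one finite torus at fixed spacing; nothing continuum ∕ mass gap ∕ Clay.

## The printed text

* p. 256 [PDF 2], after (5): «|T₁^{(k)}| = Σ_{y∈T₁^{(k)}} 1 = Σ_{x∈T_η} η³ = (Lᵏε)^{−3}|T_ε|».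
* p. 266 [PDF 12], (41): «Our inductive assumption has the following form  ρ_k(V) ≦ Σ_{{Ω_j}} ∫dV_{k−1}↾_{Z_{k−1}} δ(V̄_{k−1}V^{−1})
  ⋯ ∫dV₀↾_{Z₀} δ(V̄₀V₁^{−1}) χ_k ζ_{Λ_{k−1}} χ_{k−1} · … · ζ_{Λ₁} χ₁ ζ_{Ω₁ᶜ} × exp[−(1/g_k²)A^η(U_k) + Σ_{j=1}^{k} Σ_{Y_j} 𝒫_j(Y_j, U_k)
  − E_k + Σ_{j=0}^{k−1} O(log g_j⁻¹)|Z_j| + Σ_{j=0}^{k−1} O((Lʲε)^{3+κ₀})|T₁^{(j)}|]  (41)  Here the sets Z_j are rescaled to the unit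
  scale.»
* p. 267 [PDF 13]: «We introduce the decomposition of unity (7) for the field V on the domain Λ_k, with ε₁ = g_kp(g_k).»
* pp. 273–274 [PDF 19–20]: «To prove the inequality (5) we have to produce all small factors connected with large fields regions
  P in the functions ζ_{Λ_j}. … We get these small factors for all plaquettes in all large fields set P. … The analysis of
  Sect. 3.C [9], which is model independent, show that these small factors are enough to control all sums in (41), together
  with the second term in (65) ⟦(66)⟧. This gives the upper bound in (5).»

## What this file constructs and proves (kernel, 0 sorry, axioms standard)

The cell's kernel closure of the last sentence, `B10LargeFieldSum.largeFieldControl_of_resummation_gRun` (pub-balaban C-B10-7),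
consumes a `HistModel T` (the DISCRETE data of a history: labels `α`, candidate pairs `E k`, their count `card_E`, the large-field
pairs `disc` of a history, the volumes `zvol`, and the domination of `LF`) and three leaves `SmallFactorsAll`, `ZtermRate`,
`ZvolCover`.  Here, for the Setup torus `P : Params` at d = 3:
* §1 `PLabel P = Σ j, Plaq P j`, `embed`, `cand P k` = ALL pairs `(j, p′)`, `p′` a plaquette of `T^{(j)}`, `j < k` (standing range
  `j ≤ m + K`), `cand_lt` (= `E_lt`), `plaqsAt Q i` = the scale-i plaquettes `P_i` of a discrete history `Q`, and the fibrewise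
  regrouping `sum_filter_le_eq` (`Σ_{(i,p′)∈Q, i≤j} f(i) = Σ_{i≤j} |P_i|·f(i)`).
* §2 `card_plaq` (`#Plaq(T^{(j)}) = #{μ<ν}·|T^{(j)}|`), `card_plaq_three` (three plaquettes per site, d = 3), `card_site_mul_pow`
  (`|T^{(j)}|·L^{dj} = |T^{(0)}|`, p. 256), and **`card_cand_filter_le`** = the field `card_E`: the scale-j candidates number
  `≤ 3·e^{3 log L·(k−j)}·|T₁^{(k)}|` when `|T₁^{(k)}| = |T^{(0)}|·L^{−3k}` (`hsites`, the printed site count as carried by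
  `B10.TowerRun.sites`).
* §3 `zvolT` := `(Lʲ)^{−d}·#(Z_j of print's rule B10Eq38TorusDomains.ruleSeqPt driven by the corner points of the history's plaquettes,
  collars R₁r(g_j))` — «Here the sets Z_j are rescaled to the unit scale» — with the couplings frozen beyond K (`gTrunc`), and
  **`zvolT_le`**: `zvolT j Q ≤ Σ_{(i,p′)∈Q, i≤j} (4c_g(R₁))³·x(g_i)^{3r₀}` for every `Q ⊆ cand P k`, `j < k ≤ K` — the collar count
  `B10Eq39CollarVolume.ncard_Z_pt_le_plaquettes` BY NAME in the exact summand shape of the leaf.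
* §4 `Inputs P T M₁ R₁ r₀` — the THREE located fields without body (`disc`/`disc_sub`, `A₀`, `dominated`: dag-n08-a's N08-PIN-LIST §B
  «the history functional LF of (41) has NO body anywhere»); **`histModel`** : `HistModel T` with `α, E, E_lt, σ = 3 log L, card_E,
  zvol` CONSTRUCTED; **`zvolCover_histModel : ZvolCover (histModel …) 4 (c_g(R₁)) r₀`** — THE LEAF AS A THEOREM; and
  **`largeFieldControl_torus`** — `B10.LargeFieldControlPrinted T` from `SmallFactorsAll`, `ZtermRate`, the inputs and the printed
  flow `g_j = g(Lʲε)^{1/2}` (`largeFieldControl_of_resummation_gRun` with `hV` discharged; provisos `3r₀ + 2 ≤ 2p₀`,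
  `8(A + A₀)(4c_g)³/(½log L) ≤ c₁b₀²`, `56 ≤ c₁b₀²` verbatim).

## What is NOT claimed

(i) `LF`, its domination and the two other leaves are hypotheses; (ii) d = 3 (`hd : P.d = 3`, print) for the factor «3» of
`card_E` and the cube of the leaf; (iii) the torus site count enters through the hypothesis `hsites : T.sites k = |T^{(0)}|·L^{−3k}`
(= `B10.sitesRun` with `|T_ε| := |T^{(0)}|ε³`), the standing range through `cand` (no plaquettes beyond scale m + K); (iv) the
printed collar uses the couplings only at scales `< K` — `gTrunc` freezes them beyond K so that the monotonicity/window
hypotheses of `B10Eq39CollarVolume.ncard_Z_le_flow` are met by `0 < g_j ≤ 1` non-decreasing on `j ≤ K`; (v) `cg·ρ` of the leaf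
is realised as `4·c_g(R₁)` (the four corners of a plaquette absorbed by `4c³ ≤ (4c)³`), a waste of a factor 16 in the provisos,
immaterial for «b₀ sufficiently large».

Cell records: pub-balaban GAPS C-B10-7, G-B10-09, G-B10-10, G-adv2-7; DIVERGENCE D-b10.7; dag-n08-a N08-PIN-LIST §B/§C (L7);
SKELETON rows B10.Eq41, B10.Eq71 (lit-balaban); YM-PLAN §2b N08.
-/

noncomputable section

namespace Literature.MathematicalPhysics.QuantumFieldTheory.Balaban1983to89.B10Eq41TorusHistories

open Literature.MathematicalPhysics.QuantumFieldTheory.Balaban1983to89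
open Literature.MathematicalPhysics.QuantumFieldTheory.Balaban1983to89.B10LargeField (Z xlog)
open Literature.MathematicalPhysics.QuantumFieldTheory.Balaban1983to89.B10LargeFieldSum (HistModel ZvolCover SmallFactorsAll
  ZtermRate largeFieldControl_of_resummation_gRun)
open Literature.MathematicalPhysics.QuantumFieldTheory.Balaban1983to89.B10Eq38TorusDomains (ruleSeqPt cornerPts collarPrinted)
open Literature.MathematicalPhysics.QuantumFieldTheory.Balaban1983to89.B10Eq39CollarVolume (cgeo cgeo_nonneg
  ncard_Z_pt_le_plaquettes flow_summand_eq)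

variable {P : Params}

/-! ## §1 The discrete data of a large-field history on the torus: (scale, plaquette) pairs -/

section Labels

variable (P) in
/-- The plaquette labels of all scales: `(j, p′)` with `p′` a plaquette of `T^{(j)}` («the decomposition of unity (7) for the
field V on the domain Λ_k», p. 267, at every passage). [cite: Balaban1985UV3, (7) p.257; p.267] -/
def PLabel : Type := Σ j : ℕ, Plaq P j

/-- Equality of plaquette labels is decidable (classically). [folklore] -/
instance instDecidableEqPLabel : DecidableEq (PLabel P) := Classical.typeDecidableEq _

variable (P) in
/-- The candidate pair `(j, p′)` of a scale-`j` plaquette, as an embedding. [cite: Balaban1985UV3, p.267] -/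
def embed (j : ℕ) : Plaq P j ↪ ℕ × PLabel P :=
  ⟨fun p => (j, ⟨j, p⟩), fun p q h => by
    have h2 := (Prod.mk.inj h).2
    exact eq_of_heq (Sigma.mk.inj h2).2⟩

/-- `embed j p′ = (j, ⟨j, p′⟩)`. [cite: Balaban1985UV3, p.267] -/
@[simp] theorem embed_apply (j : ℕ) (p : Plaq P j) : embed P j p = (j, ⟨j, p⟩) := rfl

variable (P) in
/-- **The candidate pairs `E k` of step k**: all `(j, p′)`, `p′` a plaquette of `T^{(j)}`, `j < k`, within the standing range
`j ≤ m + K` of `Setup` (the plaquettes on which the decompositions (7) of the passages `j → j+1` are made, p. 267).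
[cite: Balaban1985UV3, (41) p.266; p.267] -/
def cand (k : ℕ) : Finset (ℕ × PLabel P) :=
  ((Finset.range k).filter fun j => j ≤ P.m + P.K).biUnion fun j => (Finset.univ : Finset (Plaq P j)).map (embed P j)

/-- Membership in `cand`, unfolded. [cite: Balaban1985UV3, p.267] -/
theorem mem_cand {k : ℕ} {e : ℕ × PLabel P} :
    e ∈ cand P k ↔ ∃ j, j < k ∧ j ≤ P.m + P.K ∧ ∃ p : Plaq P j, embed P j p = e := by
  simp only [cand, Finset.mem_biUnion, Finset.mem_filter, Finset.mem_range, Finset.mem_map, Finset.mem_univ,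
    true_and]
  constructor
  · rintro ⟨j, ⟨hj, hjm⟩, p, hp⟩; exact ⟨j, hj, hjm, p, hp⟩
  · rintro ⟨j, hj, hjm, p, hp⟩; exact ⟨j, ⟨hj, hjm⟩, p, hp⟩

/-- The field `E_lt` of `HistModel`: candidate pairs of step k have scale `< k`. [cite: Balaban1985UV3, (41) p.266] -/
theorem cand_lt {k : ℕ} {e : ℕ × PLabel P} (he : e ∈ cand P k) : e.1 < k := by
  obtain ⟨j, hj, -, p, rfl⟩ := mem_cand.mp he
  exact hj

/-- The scale of a candidate pair is the scale of its label. [cite: Balaban1985UV3, p.267] -/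
theorem fst_eq_of_mem_cand {k : ℕ} {e : ℕ × PLabel P} (he : e ∈ cand P k) : e.1 = e.2.1 := by
  obtain ⟨j, -, -, p, rfl⟩ := mem_cand.mp he
  rfl

/-- The scale-`i` large-field plaquettes `P_i` of a discrete history `Q` («a plaquette p′ ⊂ Λ_j and such that |V_j(∂p′) − 1| ≥
g_jp(g_j)», p. 273). [cite: Balaban1985UV3, p.267; p.273] -/
def plaqsAt (Q : Finset (ℕ × PLabel P)) (i : ℕ) : Finset (Plaq P i) := by
  classical
  exact Finset.univ.filter fun p => embed P i p ∈ Q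

/-- Membership in `plaqsAt`, unfolded. [cite: Balaban1985UV3, p.273] -/
theorem mem_plaqsAt {Q : Finset (ℕ × PLabel P)} {i : ℕ} {p : Plaq P i} : p ∈ plaqsAt Q i ↔ embed P i p ∈ Q := by
  classical
  simp [plaqsAt]

/-- The pairs of a candidate history with scale `≤ j` are the disjoint union over `i ≤ j` of the embedded `P_i`.
[cite: Balaban1985UV3, (41) p.266] -/
theorem filter_le_eq_biUnion {k : ℕ} {Q : Finset (ℕ × PLabel P)} (hQ : Q ⊆ cand P k) (j : ℕ) :
    Q.filter (fun e => e.1 ≤ j) = (Finset.range (j + 1)).biUnion fun i => (plaqsAt Q i).map (embed P i) := by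
  classical
  ext e
  simp only [Finset.mem_filter, Finset.mem_biUnion, Finset.mem_range, Finset.mem_map, mem_plaqsAt]
  constructor
  · rintro ⟨heQ, hej⟩
    obtain ⟨i, -, -, p, rfl⟩ := mem_cand.mp (hQ heQ)
    exact ⟨i, by simpa using Nat.lt_succ_of_le hej, p, heQ, rfl⟩
  · rintro ⟨i, hi, p, hp, rfl⟩
    exact ⟨hp, by simpa using Nat.le_of_lt_succ hi⟩

/-- **Fibrewise regrouping**: `Σ_{(i,p′) ∈ Q, i ≤ j} f(i) = Σ_{i ≤ j} |P_i|·f(i)` for a candidate history (the passage between the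
leaf's sum over pairs and the collar count's sum over scales). [cite: Balaban1985UV3, (41) p.266] -/
theorem sum_filter_le_eq {k : ℕ} {Q : Finset (ℕ × PLabel P)} (hQ : Q ⊆ cand P k) (j : ℕ) (f : ℕ → ℝ) :
    ∑ e ∈ Q.filter (fun e => e.1 ≤ j), f e.1 = ∑ i ∈ Finset.range (j + 1), ((plaqsAt Q i).card : ℝ) * f i := by
  classical
  rw [filter_le_eq_biUnion hQ j, Finset.sum_biUnion]
  · refine Finset.sum_congr rfl fun i _ => ?_
    rw [Finset.sum_map]
    simp only [embed_apply, Finset.sum_const, nsmul_eq_mul]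
  · intro i _ i' _ hii'
    simp only [Function.onFun]
    rw [Finset.disjoint_left]
    intro e he he'
    rw [Finset.mem_map] at he he'
    obtain ⟨p, -, rfl⟩ := he
    obtain ⟨p', -, h⟩ := he'
    exact hii' ((Prod.mk.inj h).1).symm

end Labels

/-! ## §2 The counts: three plaquettes per site (d = 3), `|T₁^{(j)}| = L^{3(k−j)}|T₁^{(k)}|`, and `card_E` -/

section Counts

/-- Three plaquette orientations `μ < ν` in three dimensions. [folklore] -/
private theorem card_pairs_three : ∀ n : ℕ, n = 3 →
    ((Finset.univ : Finset (Fin n × Fin n)).filter fun t => t.1 < t.2).card = 3 := by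
  rintro n rfl
  decide

/-- `#Plaq(T^{(j)}) = |T^{(j)}|·#{(μ, ν) : μ < ν}` (the plaquettes of `Setup` are pairs (site, μ < ν)). [cite: Balaban1985UV3, (7) p.257] -/
theorem card_plaq (P : Params) (j : ℕ) :
    Fintype.card (Plaq P j) =
      Fintype.card (Site P j) * ((Finset.univ : Finset (Fin P.d × Fin P.d)).filter fun t => t.1 < t.2).card := by
  classical
  rw [show Fintype.card (Plaq P j) = Fintype.card {t : Site P j × Fin P.d × Fin P.d // t.2.1 < t.2.2} from
    Fintype.ofEquiv_card _]
  rw [Fintype.card_subtype]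
  have h : (Finset.univ.filter fun t : Site P j × Fin P.d × Fin P.d => t.2.1 < t.2.2)
      = (Finset.univ : Finset (Site P j)) ×ˢ
          ((Finset.univ : Finset (Fin P.d × Fin P.d)).filter fun t => t.1 < t.2) := by
    rw [← Finset.filter_product_right (q := fun t : Fin P.d × Fin P.d => t.1 < t.2), Finset.univ_product_univ]
  rw [h, Finset.card_product, Finset.card_univ]

/-- **Three plaquettes per site** in d = 3: `#Plaq(T^{(j)}) = 3|T^{(j)}|` (the count behind `HistModel.card_E`'s factor 3).
[cite: Balaban1985UV3, (5) p.256; (7) p.257] -/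
theorem card_plaq_three (hd : P.d = 3) (j : ℕ) : Fintype.card (Plaq P j) = 3 * Fintype.card (Site P j) := by
  rw [card_plaq, card_pairs_three P.d hd, mul_comm]

/-- «|T₁^{(k)}| = Σ_{y∈T₁^{(k)}} 1 = Σ_{x∈T_η} η³ = (Lᵏε)^{−3}|T_ε|» (p. 256) on Setup's tori: `|T^{(j)}|·(L^d)ʲ = |T^{(0)}|` in the
standing range `j ≤ m + K` (`TorusGeometry`'s `Site.card_site_eq_mul_succ` iterated). [cite: Balaban1985UV3, (5) p.256] -/
theorem card_site_mul_pow {j : ℕ} (hj : j ≤ P.m + P.K) :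
    Fintype.card (Site P j) * (P.L ^ P.d) ^ j = Fintype.card (Site P 0) := by
  induction j with
  | zero => simp
  | succ j ih =>
    have hj' : j ≤ P.m + P.K := by omega
    rw [← ih hj', Site.card_site_eq_mul_succ hj, pow_succ]
    ring

/-- The same in the reals: `|T^{(j)}| = |T^{(0)}|·(L^d)^{−j}`. [cite: Balaban1985UV3, (5) p.256] -/
theorem card_site_eq_real {j : ℕ} (hj : j ≤ P.m + P.K) :
    (Fintype.card (Site P j) : ℝ) = (Fintype.card (Site P 0) : ℝ) * (((P.L : ℝ) ^ P.d)⁻¹) ^ j := by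
  have hL : (0 : ℝ) < (P.L : ℝ) ^ P.d := by have := P.L_pos; positivity
  have h := card_site_mul_pow (P := P) hj
  have h' : (Fintype.card (Site P j) : ℝ) * ((P.L : ℝ) ^ P.d) ^ j = Fintype.card (Site P 0) := by
    exact_mod_cast h
  rw [← h', inv_pow, mul_assoc, mul_inv_cancel₀ (pow_ne_zero _ hL.ne'), mul_one]

/-- `e^{d log L·(k−j)} = (L^d)^{k−j}`. [folklore] -/
private theorem exp_sigma (k j : ℕ) :
    Real.exp ((P.d : ℝ) * Real.log P.L * ((k - j : ℕ) : ℝ)) = ((P.L : ℝ) ^ P.d) ^ (k - j) := by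
  have hL : (0 : ℝ) < P.L := by exact_mod_cast P.L_pos
  rw [show (P.d : ℝ) * Real.log P.L * ((k - j : ℕ) : ℝ) = ((P.d * (k - j) : ℕ) : ℝ) * Real.log P.L by
    push_cast; ring, Real.exp_nat_mul, Real.exp_log hL, pow_mul]

/-- **The field `card_E` of `HistModel` on the torus**: the candidates of scale `j < k` number `#Plaq(T^{(j)}) = 3|T₁^{(j)}| =
3·e^{3 log L·(k−j)}·|T₁^{(k)}|` (d = 3) when the run's site count is the torus's, `T.sites k = |T^{(0)}|·L^{−3k}` (p. 256); empty
beyond the standing range. [cite: Balaban1985UV3, (5) p.256; (41) p.266] -/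
theorem card_cand_filter_le (hd : P.d = 3) {sites : ℕ → ℝ}
    (hsites : ∀ k, sites k = (Fintype.card (Site P 0) : ℝ) * (((P.L : ℝ) ^ P.d)⁻¹) ^ k) {k j : ℕ} (hjk : j < k) :
    (((cand P k).filter fun e => e.1 = j).card : ℝ) ≤ 3 * Real.exp (3 * Real.log P.L * ((k - j : ℕ) : ℝ)) * sites k := by
  classical
  have hL : (0 : ℝ) < (P.L : ℝ) ^ P.d := by have := P.L_pos; positivity
  by_cases hjm : j ≤ P.m + P.K
  · -- the filter is the embedded copy of all plaquettes of scale j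
    have hfilter : (cand P k).filter (fun e => e.1 = j) = (Finset.univ : Finset (Plaq P j)).map (embed P j) := by
      ext e
      simp only [Finset.mem_filter, Finset.mem_map, Finset.mem_univ, true_and]
      constructor
      · rintro ⟨he, hej⟩
        obtain ⟨i, -, -, p, rfl⟩ := mem_cand.mp he
        simp only [embed_apply] at hej
        subst hej
        exact ⟨p, rfl⟩
      · rintro ⟨p, rfl⟩
        exact ⟨mem_cand.mpr ⟨j, hjk, hjm, p, rfl⟩, rfl⟩
    rw [hfilter, Finset.card_map, Finset.card_univ, card_plaq_three hd]
    push_cast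
    rw [card_site_eq_real hjm, hsites k,
      show (3 : ℝ) * Real.log P.L = (P.d : ℝ) * Real.log P.L by rw [hd]; norm_num, exp_sigma]
    have hpow : ((P.L : ℝ) ^ P.d) ^ k = ((P.L : ℝ) ^ P.d) ^ (k - j) * ((P.L : ℝ) ^ P.d) ^ j := by
      rw [← pow_add, Nat.sub_add_cancel hjk.le]
    have hkj : ((P.L : ℝ) ^ P.d) ^ (k - j) * (((P.L : ℝ) ^ P.d)⁻¹) ^ k = (((P.L : ℝ) ^ P.d)⁻¹) ^ j := by
      rw [inv_pow, inv_pow, hpow, mul_inv, ← mul_assoc, mul_inv_cancel₀ (pow_ne_zero _ hL.ne'), one_mul]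
    apply le_of_eq
    calc (3 : ℝ) * ((Fintype.card (Site P 0) : ℝ) * (((P.L : ℝ) ^ P.d)⁻¹) ^ j)
        = 3 * ((Fintype.card (Site P 0) : ℝ) * (((P.L : ℝ) ^ P.d) ^ (k - j) * (((P.L : ℝ) ^ P.d)⁻¹) ^ k)) := by
          rw [hkj]
      _ = 3 * ((P.L : ℝ) ^ P.d) ^ (k - j) * ((Fintype.card (Site P 0) : ℝ) * (((P.L : ℝ) ^ P.d)⁻¹) ^ k) := by
          ring
  · have hempty : (cand P k).filter (fun e => e.1 = j) = ∅ := by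
      ext e
      simp only [Finset.mem_filter, Finset.notMem_empty, iff_false, not_and]
      intro he hej
      obtain ⟨i, -, him, p, rfl⟩ := mem_cand.mp he
      simp only [embed_apply] at hej
      omega
    rw [hempty, Finset.card_empty, Nat.cast_zero]
    have : 0 ≤ sites k := by rw [hsites]; positivity
    positivity

end Counts

/-! ## §3 The volume `|Z_j|` of a discrete history on the torus rule, in `Lʲη`-units, and the leaf `ZvolCover` as a theorem -/

section Volume

/-- The coupling sequence frozen beyond the last step `K` (`g_{min(i,K)}`): the rule's collars `R(g_j)` are used at scales
`j < K` only, where `gTrunc` agrees with `g`. [cite: Balaban1985UV3, (39) p.266] -/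
def gTrunc (g : ℕ → ℝ) (K : ℕ) (i : ℕ) : ℝ := g (min i K)

/-- `gTrunc g K i = g i` for `i ≤ K`. [cite: Balaban1985UV3, (39) p.266] -/
theorem gTrunc_of_le {g : ℕ → ℝ} {K i : ℕ} (hi : i ≤ K) : gTrunc g K i = g i := by
  simp [gTrunc, min_eq_left hi]

/-- A sequence non-decreasing up to `K` freezes to a monotone one. [cite: Balaban1985UV3, (5) p.256] -/
theorem gTrunc_mono {g : ℕ → ℝ} {K : ℕ} (hmono : ∀ i j, i ≤ j → j ≤ K → g i ≤ g j) : Monotone (gTrunc g K) := by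
  intro i j hij
  unfold gTrunc
  exact hmono _ _ (min_le_min_right K hij) (min_le_right _ _)

/-- The frozen sequence stays in the window `(0, 1]` of the run. [cite: Balaban1985UV3, (5) p.256] -/
theorem gTrunc_mem {g : ℕ → ℝ} {K : ℕ} (hg : ∀ j, j ≤ K → 0 < g j ∧ g j ≤ 1) (i : ℕ) :
    0 < gTrunc g K i ∧ gTrunc g K i ≤ 1 :=
  hg _ (min_le_right _ _)

variable (P) in
/-- The point sets `P_i ⊂ T_η` of a discrete history: the corners of its scale-`i` large-field plaquettes
(`B10Eq38TorusDomains.cornerPts`), feeding the rule «distances to P ∪ Ω_k^{(k)c}» (p. 268). [cite: Balaban1985UV3, p.268] -/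
def srcPts (Q : Finset (ℕ × PLabel P)) (i : ℕ) : Set (Site P 0) := cornerPts i (plaqsAt Q i)

variable (P) in
/-- **`|Z_j|` of a discrete history in `Lʲη`-units** («Here the sets Z_j are rescaled to the unit scale», p. 266): the fine-site
count of `Z_j = Ω_{j+1}ᶜ` for print's rule `B10Eq38TorusDomains.ruleSeqPt` (Ω₀ = T_η, collars `R₁r(g_j)`, sources = the corners
of the history's large-field plaquettes), divided by `(Lʲ)^d`. [cite: Balaban1985UV3, (41) p.266; p.268] -/
def zvolT (M₁ : ℕ) (R₁ r₀ : ℝ) (g : ℕ → ℝ) (K : ℕ) (j : ℕ) (Q : Finset (ℕ × PLabel P)) : ℝ :=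
  (((P.L : ℝ) ^ j) ^ P.d)⁻¹ *
    ((Z (ruleSeqPt P M₁ (collarPrinted R₁ r₀ (gTrunc g K)) Set.univ (srcPts P Q)) j).ncard : ℝ)

/-- `zvolT ≥ 0`. [cite: Balaban1985UV3, (41) p.266] -/
theorem zvolT_nonneg (M₁ : ℕ) (R₁ r₀ : ℝ) (g : ℕ → ℝ) (K j : ℕ) (Q : Finset (ℕ × PLabel P)) :
    0 ≤ zvolT P M₁ R₁ r₀ g K j Q := by
  unfold zvolT
  have := P.L_pos
  positivity

/-- **THE COUNTED COLLAR COVER in the exact summand shape of the leaf `ZvolCover`, on the torus** (d = 3): for every discrete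
history `Q ⊆ cand P k`, `k ≤ K`, `j < k`, with `M₁ ≥ 1`, `R₁, r₀ ≥ 0` and couplings `0 < g_j ≤ 1` non-decreasing up to `K`:
`zvolT j Q ≤ Σ_{(i,p′) ∈ Q, i ≤ j} (4·c_g(R₁))³·x(g_i)^{3r₀}` — `B10Eq39CollarVolume.ncard_Z_pt_le_plaquettes` BY NAME, the four
corners absorbed by `4c³ ≤ (4c)³`, regrouped fibrewise (§1). [cite: Balaban1985UV3, (39) p.266; (41) p.266; pp.273–274] -/
theorem zvolT_le (hd : P.d = 3) {M₁ : ℕ} (hM : 0 < M₁) {R₁ r₀ : ℝ} (hR : 0 ≤ R₁) (hr : 0 ≤ r₀) {g : ℕ → ℝ} {K : ℕ}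
    (hg : ∀ j, j ≤ K → 0 < g j ∧ g j ≤ 1) (hmono : ∀ i j, i ≤ j → j ≤ K → g i ≤ g j)
    {k : ℕ} (hk : k ≤ K) {Q : Finset (ℕ × PLabel P)} (hQ : Q ⊆ cand P k) {j : ℕ} (hjk : j < k) :
    zvolT P M₁ R₁ r₀ g K j Q ≤
      ∑ e ∈ Q.filter (fun e => e.1 ≤ j), (4 * cgeo P M₁ R₁) ^ 3 * xlog (g e.1) ^ (3 * r₀) := by
  have hL : (0 : ℝ) < ((P.L : ℝ) ^ j) ^ P.d := by have := P.L_pos; positivity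
  have hmain := ncard_Z_pt_le_plaquettes (P := P) hM hR hr (gTrunc_mem hg) (gTrunc_mono hmono) (plaqsAt Q) j
  -- divide by (Lʲ)^d
  have h1 : zvolT P M₁ R₁ r₀ g K j Q ≤
      ∑ i ∈ Finset.range (j + 1), 4 * ((plaqsAt Q i).card : ℝ) * (cgeo P M₁ R₁ * xlog (gTrunc g K i) ^ r₀) ^ P.d := by
    unfold zvolT srcPts
    rw [inv_mul_le_iff₀ hL]
    exact hmain
  refine h1.trans ?_
  rw [sum_filter_le_eq hQ j (fun i => (4 * cgeo P M₁ R₁) ^ 3 * xlog (g i) ^ (3 * r₀))]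
  refine Finset.sum_le_sum fun i hi => ?_
  have hij : i ≤ K := by
    have := Finset.mem_range.mp hi
    omega
  rw [gTrunc_of_le hij, hd]
  have hx : 0 ≤ xlog (g i) := by
    have := B10LargeField.one_le_xlog (hg i hij).1 (hg i hij).2
    linarith
  rw [flow_summand_eq (cgeo P M₁ R₁) hx r₀ 3]
  have hc : 0 ≤ cgeo P M₁ R₁ := cgeo_nonneg hR
  have hcard : (0 : ℝ) ≤ (plaqsAt Q i).card := Nat.cast_nonneg _
  push_cast
  have hxr : 0 ≤ xlog (g i) ^ ((3 : ℝ) * r₀) := Real.rpow_nonneg hx _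
  have hm : 0 ≤ ((plaqsAt Q i).card : ℝ) * (cgeo P M₁ R₁ ^ 3 * xlog (g i) ^ ((3 : ℝ) * r₀)) :=
    mul_nonneg hcard (mul_nonneg (pow_nonneg hc 3) hxr)
  calc 4 * ((plaqsAt Q i).card : ℝ) * (cgeo P M₁ R₁ ^ 3 * xlog (g i) ^ ((3 : ℝ) * r₀))
      = 4 * (((plaqsAt Q i).card : ℝ) * (cgeo P M₁ R₁ ^ 3 * xlog (g i) ^ ((3 : ℝ) * r₀))) := by ring
    _ ≤ 64 * (((plaqsAt Q i).card : ℝ) * (cgeo P M₁ R₁ ^ 3 * xlog (g i) ^ ((3 : ℝ) * r₀))) :=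
        mul_le_mul_of_nonneg_right (by norm_num) hm
    _ = ((plaqsAt Q i).card : ℝ) * ((4 * cgeo P M₁ R₁) ^ 3 * xlog (g i) ^ ((3 : ℝ) * r₀)) := by ring

end Volume

/-! ## §4 The torus `HistModel` with the three located fields as INPUTS, and the leaf `ZvolCover` as a THEOREM -/

section Model

variable {T : B10.TowerRun}

variable (P) in
/-- **THE INPUTS WITHOUT BODY** — the three fields of `B10LargeFieldSum.HistModel` that refer to the history functional `LF` of
(41) «Σ_{{Ω_j}} ∫dV_{k−1}↾_{Z_{k−1}} ⋯» (no body in the tree: dag-n08-a's N08-PIN-LIST §B): the large-field pairs `disc k h` of a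
history `h` (inside the candidates), the volume rate `A₀ ≥ 0`, and the DOMINATION of `LF` by the sum over discrete histories
weighted by `zvolT`.  Everything else of the model is constructed in `histModel`. [cite: Balaban1985UV3, (41) p.266; pp.273–274] -/
structure Inputs (T : B10.TowerRun) (M₁ : ℕ) (R₁ r₀ : ℝ) where
  /-- the large-field plaquettes `{(j, p′) : p′ ∈ P_j}` of a history -/
  disc : (k : ℕ) → T.Hist k → Finset (ℕ × PLabel P)
  /-- they are candidate pairs of the step -/
  disc_sub : ∀ k h, disc k h ⊆ cand P k
  /-- the rate of the volume terms kept inside the domination -/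
  A₀ : ℝ
  A₀_nonneg : 0 ≤ A₀
  /-- how (41) is USED: the functional is dominated by the sum over discrete histories -/
  dominated : ∀ k, k ≤ T.K → ∀ (U : T.Cfg k) (F : T.Hist k → ℝ) (B : Finset (ℕ × PLabel P) → ℝ),
    (∀ h, F h ≤ B (disc k h)) →
      T.LF k U F ≤ ∑ Q ∈ (cand P k).powerset,
        Real.exp (B Q + A₀ * ∑ j ∈ Finset.range k, zvolT P M₁ R₁ r₀ T.g T.K j Q)

/-- **THE TORUS `HistModel T`** (the cell's refined history carrier of (41), `B10LargeFieldSum.HistModel`, CONSTRUCTED): `α :=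
PLabel P`, `E := cand P`, `E_lt := cand_lt`, `σ := 3 log L`, `card_E := card_cand_filter_le` (PROVED, d = 3, under the printed
site count `hsites`), `zvol k j Q := zvolT … j Q`; `disc`, `A₀`, `dominated` from the `Inputs`. [cite: Balaban1985UV3, (41) p.266; pp.273–274] -/
def histModel (hd : P.d = 3) {M₁ : ℕ} {R₁ r₀ : ℝ} (I : Inputs P T M₁ R₁ r₀)
    (hsites : ∀ k, T.sites k = (Fintype.card (Site P 0) : ℝ) * (((P.L : ℝ) ^ P.d)⁻¹) ^ k) : HistModel T where
  α := PLabel P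
  E := cand P
  E_lt := fun _ _ he => cand_lt he
  σ := 3 * Real.log P.L
  card_E := fun _ _ hjk => card_cand_filter_le hd hsites hjk
  disc := I.disc
  disc_sub := I.disc_sub
  zvol := fun _ j Q => zvolT P M₁ R₁ r₀ T.g T.K j Q
  A₀ := I.A₀
  A₀_nonneg := I.A₀_nonneg
  dominated := I.dominated

/-- **THE LEAF `ZvolCover` OF THE SECT. D KERNEL CLOSURE IS A THEOREM on the torus model**: `ZvolCover (histModel …) 4 (c_g(R₁)) r₀`
for `M₁ ≥ 1`, `R₁, r₀ ≥ 0` and the run's couplings `0 < g_j ≤ 1` non-decreasing on `j ≤ K` (d = 3: `g_j = g(Lʲε)^{1/2}` grows,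
p. 256) — `zvolT_le`. [cite: Balaban1985UV3, (39) p.266; (41) p.266; pp.273–274] -/
theorem zvolCover_histModel (hd : P.d = 3) {M₁ : ℕ} (hM : 0 < M₁) {R₁ r₀ : ℝ} (hR : 0 ≤ R₁) (hr : 0 ≤ r₀)
    (I : Inputs P T M₁ R₁ r₀)
    (hsites : ∀ k, T.sites k = (Fintype.card (Site P 0) : ℝ) * (((P.L : ℝ) ^ P.d)⁻¹) ^ k)
    (hg : ∀ j, j ≤ T.K → 0 < T.g j ∧ T.g j ≤ 1) (hmono : ∀ i j, i ≤ j → j ≤ T.K → T.g i ≤ T.g j) :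
    ZvolCover (histModel hd I hsites) 4 (cgeo P M₁ R₁) r₀ := by
  intro k hk Q hQ j hjk
  exact zvolT_le hd hM hR hr hg hmono hk hQ hjk

/-- **«these small factors are enough to control all sums in (41)» ON THE TORUS MODEL, one leaf fewer** (pp. 273–274):
`B10LargeFieldSum.largeFieldControl_of_resummation_gRun` BY NAME with its volume leaf `ZvolCover` DISCHARGED by
`zvolCover_histModel` — from the small factors (67)–(71) as the bound `SmallFactorsAll` on the main action, the Z-term rate
`ZtermRate`, the `Inputs`, the printed flow `g_j = g(Lʲε)^{1/2}` with `0 < g_j ≤ g̃ ≤ 1` (j ≤ K) and `L = P.L`, under the provisos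
`3r₀ + 2 ≤ 2p₀` (cell GAPS G-B10-02), `8(A + A₀)(4c_g)³/(½ log L) ≤ c₁b₀²`, `56 ≤ c₁b₀²` («b₀ is a sufficiently large absolute
constant», p. 257): `B10.LargeFieldControlPrinted T` — the LeafSystem field (L7) `lf` of `B10Assembly` on print's carrier modulo
the named inputs. [cite: Balaban1985UV3, pp.273–274; (66) p.273; (7) p.257] -/
theorem largeFieldControl_torus (hd : P.d = 3) {M₁ : ℕ} (hM : 0 < M₁) {R₁ r₀ : ℝ} (hR : 0 ≤ R₁) (hr : 0 ≤ r₀)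
    (I : Inputs P T M₁ R₁ r₀)
    (hsites : ∀ k, T.sites k = (Fintype.card (Site P 0) : ℝ) * (((P.L : ℝ) ^ P.d)⁻¹) ^ k)
    {A c₁ gs g L ε : ℝ}
    (hSF : SmallFactorsAll (histModel hd I hsites) c₁ gs) (hZ : ZtermRate (histModel hd I hsites) A)
    (hA : 0 ≤ A) (hc₁ : 0 ≤ c₁) (hg0 : 0 < g) (hL : 1 < L) (hε : 0 < ε)
    (hrun : ∀ j, T.g j = B10.gRun g L ε j)
    (hgK : ∀ j, j ≤ T.K → 0 < T.g j ∧ T.g j ≤ gs) (hgs : gs ≤ 1)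
    (hLP : L = P.L)
    (hp : r₀ * 3 + 2 ≤ 2 * T.p₀)
    (hb₁ : 8 * ((A + I.A₀) * (4 * cgeo P M₁ R₁) ^ 3 / (Real.log L / 2)) ≤ c₁ * T.b₀ ^ 2)
    (hb₂ : 56 ≤ c₁ * T.b₀ ^ 2) :
    B10.LargeFieldControlPrinted T := by
  have hg1 : ∀ j, j ≤ T.K → 0 < T.g j ∧ T.g j ≤ 1 := fun j hj => ⟨(hgK j hj).1, (hgK j hj).2.trans hgs⟩
  have hmono : ∀ i j, i ≤ j → j ≤ T.K → T.g i ≤ T.g j := by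
    intro i j hij _
    rw [hrun i, hrun j]
    unfold B10.gRun
    have hL0 : (0 : ℝ) ≤ L := by linarith
    have : L ^ i * ε ≤ L ^ j * ε := mul_le_mul_of_nonneg_right (pow_le_pow_right₀ hL.le hij) hε.le
    exact mul_le_mul_of_nonneg_left (Real.sqrt_le_sqrt this) hg0.le
  have hV := zvolCover_histModel hd hM hR hr I hsites hg1 hmono
  have hcg : (0 : ℝ) ≤ 4 * cgeo P M₁ R₁ := by have := cgeo_nonneg (P := P) (M₁ := M₁) hR; positivity
  exact largeFieldControl_of_resummation_gRun (histModel hd I hsites) hSF hZ hV hA hc₁ hcg hr hg0 hL hε hrun hgK hgs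
    (by show 3 * Real.log P.L = 3 * Real.log L; rw [hLP]) hp hb₁ hb₂

end Model

end Literature.MathematicalPhysics.QuantumFieldTheory.Balaban1983to89.B10Eq41TorusHistories

end
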